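import Mathlib
import HarnessLib
import Summits.AtomisticToContinuum.FouriersLaw.Theses.BoundaryEscapeDeficit

/-!
# Birth skeleton (BC3) for crux `BoundaryEscapeDeficit.DiffusiveCrossover`
(item `stmt-AtomisticToContinuum-12236`, route `route-AtomisticToContinuum-BoundaryEscapeDeficit`, crux rank 3;
sub-problem `FouriersLaw`; registrar `planner-skel-stmt-AtomisticToContinuum-12236-0`, 2026-08-17)

Crux (FIXED, concluded BY NAME below). Notation of the route: for `P = pinnedChain ω₂ lam β γ` (all `> 0`)
and `T > 0`, `K_L(u)` is the equilibrium autocorrelation of the boundary kinetic energy `p_0² − T` of the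
`L`-site chain with BOTH Langevin baths at `T` (constructed kernel `P.transitionKernel L T T u`, Gibbs
measure `P.gibbsMeasure L T`), `θ_L(t) = (γ/T²)∫_0^t K_L` the boundary thermalisation curve,
`E_N = 1 − (γ/T²)∫_0^∞ K_N` the ESCAPE DEFICIT. Write `D_L(t) := 1 − θ_L(t)` (deficit curve; `E_N = D_N(∞)`).
DIFFUSIVE CROSSOVER: `∃ a₀ a₁ c₂ > 0, C₂ : ∀ᶠ N, ∀ᶠ M, c₂·D_M(a₁N²) ≤ E_N ≤ C₂·D_M(a₀N²)` — the escape deficit of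
the `N`-chain is comparable to what the half-line proxy (length `M → ∞`) still retains at times `≍ N²`.

## Line `birth` — TIME GAP × SPACE GAP, each split by sign (four registered stubs)

Any proof must cross two gaps: TIME (`t = ∞` in `E_N` versus `t = aN²`) inside ONE finite chain, and SPACE
(the `N`-chain versus the `M`-chain, `M → ∞`, at the SAME time `aN²`). The line cuts exactly there:

* `stub_lateSaturation` (time, lower): `∃ a₁, c > 0 : ∀ᶠ N, c·D_N(a₁N²) ≤ E_N` — what has not come back to
  site 0 by the diffusive time mostly never comes back: the late tail `(γ/T²)∫_{a₁N²}^∞ K_N` is at most the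
  fraction `1 − c` of the deficit at `a₁N²`. Continuum shadow: `D_N(t) = E_N + Σ_k A_k e^{−λ_k t}`,
  `λ₁ ≍ N⁻²`, `A₁ ≍ E_N ≍ 1/N`. Needs decay of ONE autocorrelation at rate `≳ N⁻²` (the harmonic L²-gap is
  `N⁻³`, BeckerMenegaki2022) AND an Ohmic floor `E_N` not `≪` the slow-mode amplitude. Size L (hardest).
* `stub_noOvershoot` (time, upper): `∀ a > 0, ∃ C : ∀ᶠ N, E_N ≤ C·D_N(aN²)` — the deficit at a diffusive time
  never undershoots its terminal value by more than a factor (maximum-principle shadow: `D_N(t) ↓ E_N`, `C = 1`);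
  for the chain: no late NEGATIVE lobe of `∫ K_N` at scale `N²` comparable to `E_N`. Size M–L.
* `stub_farBathSign` (space, lower): `∀ a > 0, ∃ c' > 0 : ∀ᶠ N, ∀ᶠ M, c'·D_M(aN²) ≤ D_N(aN²)` — moving the
  far bath away never (up to a factor; `c' = 1` expected) REDUCES the boundary deficit: an absorbing far bath
  returns less energy to site 0 than the continuing half-line. Sign control of `K_M − K_N` beyond the light
  cone; the slack `c' < 1` absorbs exponentially small ballistic echoes off the thermostatted end. Size M–L.
* `stub_farBathCost` (space, upper): `∃ a₀ > 0, C' : ∀ᶠ N, ∀ᶠ M, D_N(a₀N²) ≤ C'·D_M(a₀N²)` — at an (early)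
  diffusive time the far bath costs at most a bounded FACTOR: continuum ratio `1 + ℓ√a₀/A` (Kapitza length `ℓ`,
  half-line tail amplitude `A`). Fails iff the finite chain's deficit is parametrically larger than the
  half-line retention at the same time (bounded response in ratio form). Size L.
* COMPOSITION (sorry-free, pure real analysis `crossover_of_saturation_of_comparison`): lower bound =
  lateSaturation ∘ farBathSign at `a₁` (`c₂ = c·c'`); upper bound = noOvershoot ∘ farBathCost at `a₀`
  (`C₂ = C·C'` if `C ≥ 0`, else `C·c'₀` using farBathSign at `a₀`, the sign of `C` flipping the comparison);
  one common witness set of the `∀ᶠ N` / `∀ᶠ M` filters. `DiffusiveCrossover_of` is that term at the crux's name.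

Why the cut is not a costume: stubs 1–2 mention no second chain (`M`), stubs 3–4 mention no `t = ∞` quantity
(`E`); none implies the crux or `FouriersLaw` by `first | exact? | simpa | aesop` (BC3 probes, folder `bc/`);
conversely the crux implies none of them (it never compares `E_N` with `D_N`, nor `D_N` with `D_M`).
Refuter mesh (item evidence MeshConcrete.lean): modulo `HalfChainTailLaw` the crux ⟺ the Ohmic bracket
`c/N ≤ E_N ≤ C/N`; this line deliberately does NOT import the rank-2 crux — all four stubs are RELATIVE
statements (no rates), so the item stays attackable independently of the tail law, as the route intends.
Disproof used: none on file (`ledger crux ls stmt-AtomisticToContinuum-12236`: no workfiles, no `Disproof.lean`,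
no `Negative/` lemma, 2026-08-17); negatives index: no FouriersLaw statement refuted.
-/

noncomputable section

namespace Summit.AtomisticToContinuum.FouriersLaw.Cruxes.DiffusiveCrossover

namespace Birth

open Filter MeasureTheory

/-! ## The four registered stubs -/

/-- **stub 1 — `stub_lateSaturation` (TIME gap, lower side; the load-bearing stub).**
For `pinnedChain ω₂ lam β γ` (all `> 0`) and `T > 0` there are `a₁ > 0` and `c > 0` such that for all
large `N`: `c · (1 − θ_N(a₁N²)) ≤ E_N` — the terminal escape deficit is at least a fixed fraction of the
deficit the SAME finite chain shows at the diffusive time `a₁N²` ("what has not returned by the diffusive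
time mostly never returns"). Equivalently the late tail `(γ/T²)∫_{a₁N²}^∞ K_N ≤ (1 − c)(1 − θ_N(a₁N²))`. -/
theorem stub_lateSaturation :
    ∀ ω₂ lam β γ : ℝ, 0 < ω₂ → 0 < lam → 0 < β → 0 < γ → ∀ T : ℝ, 0 < T → (let P := Literature.MathematicalPhysics.KineticTheory.HeatConduction.pinnedChain ω₂ lam β γ; let K : ℕ → ℝ → ℝ := fun N u => if h : 0 < N then ∫ z, ((z.2 ⟨0, h⟩) ^ 2 - T) * (∫ y, ((y.2 ⟨0, h⟩) ^ 2 - T) ∂(P.transitionKernel N T T u.toNNReal z)) ∂(P.gibbsMeasure N T) else 0; let θ : ℕ → ℝ → ℝ := fun N t => γ / T ^ 2 * ∫ u in (0 : ℝ)..t, K N u; let E : ℕ → ℝ := fun N => 1 - γ / T ^ 2 * ∫ u in Set.Ioi (0 : ℝ), K N u; ∃ a₁ c : ℝ, 0 < a₁ ∧ 0 < c ∧ ∀ᶠ N : ℕ in Filter.atTop, c * (1 - θ N (a₁ * (N : ℝ) ^ 2)) ≤ E N) := by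
  sorry

/-- **stub 2 — `stub_noOvershoot` (TIME gap, upper side).**
For `pinnedChain ω₂ lam β γ` (all `> 0`), `T > 0` and EVERY `a > 0` there is `C` such that for all large
`N`: `E_N ≤ C · (1 − θ_N(aN²))` — the boundary deficit at a diffusive time never undershoots its terminal
value by more than a factor (continuum: monotone saturation, `C = 1`); equivalently (for `C ≥ 1`) the late
tail satisfies `(γ/T²)∫_{aN²}^∞ K_N ≥ −(1 − 1/C)·E_N`: no negative lobe of the integrated autocorrelation at
scale `N²` comparable to the deficit itself. -/
theorem stub_noOvershoot :
    ∀ ω₂ lam β γ : ℝ, 0 < ω₂ → 0 < lam → 0 < β → 0 < γ → ∀ T : ℝ, 0 < T → (let P := Literature.MathematicalPhysics.KineticTheory.HeatConduction.pinnedChain ω₂ lam β γ; let K : ℕ → ℝ → ℝ := fun N u => if h : 0 < N then ∫ z, ((z.2 ⟨0, h⟩) ^ 2 - T) * (∫ y, ((y.2 ⟨0, h⟩) ^ 2 - T) ∂(P.transitionKernel N T T u.toNNReal z)) ∂(P.gibbsMeasure N T) else 0; let θ : ℕ → ℝ → ℝ := fun N t => γ / T ^ 2 * ∫ u in (0 :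 ℝ)..t, K N u; let E : ℕ → ℝ := fun N => 1 - γ / T ^ 2 * ∫ u in Set.Ioi (0 : ℝ), K N u; ∀ a : ℝ, 0 < a → ∃ C : ℝ, ∀ᶠ N : ℕ in Filter.atTop, E N ≤ C * (1 - θ N (a * (N : ℝ) ^ 2))) := by
  sorry

/-- **stub 3 — `stub_farBathSign` (SPACE gap, lower side: sign of the far-bath effect).**
For `pinnedChain ω₂ lam β γ` (all `> 0`), `T > 0` and EVERY `a > 0` there is `c' > 0` such that for all
large `N`, eventually in the length `M`: `c' · (1 − θ_M(aN²)) ≤ 1 − θ_N(aN²)` — moving the far bath away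
(`N ↦ M → ∞`) never reduces the boundary deficit at the diffusive time by more than a factor; expected
with `c' = 1` (an absorbing far bath only removes energy that would otherwise return to site 0), the slack
absorbing exponentially small ballistic echoes off the thermostatted end site. -/
theorem stub_farBathSign :
    ∀ ω₂ lam β γ : ℝ, 0 < ω₂ → 0 < lam → 0 < β → 0 < γ → ∀ T : ℝ, 0 < T → (let P := Literature.MathematicalPhysics.KineticTheory.HeatConduction.pinnedChain ω₂ lam β γ; let K : ℕ → ℝ → ℝ := fun N u => if h : 0 < N then ∫ z, ((z.2 ⟨0, h⟩) ^ 2 - T) * (∫ y, ((y.2 ⟨0, h⟩) ^ 2 - T) ∂(P.transitionKernel N T T u.toNNReal z)) ∂(P.gibbsMeasure N T) else 0; let θ : ℕ → ℝ → ℝ := fun N t => γ / T ^ 2 * ∫ u in (0 : ℝ)..t, K N u; ∀ a : ℝ, 0 < a → ∃ c' : ℝ, 0 < c' ∧ ∀ᶠ N : ℕ in Filter.atTop, ∀ᶠ M : ℕ in Filter.atTop, c' * (1 - θ M (a * (N : ℝ) ^ 2)) ≤ 1 - θ N (a * (N : ℝ) ^ 2)) := by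
  sorry

/-- **stub 4 — `stub_farBathCost` (SPACE gap, upper side: the far bath costs at most a factor).**
For `pinnedChain ω₂ lam β γ` (all `> 0`) and `T > 0` there are `a₀ > 0` and `C'` such that for all large
`N`, eventually in the length `M`: `1 − θ_N(a₀N²) ≤ C' · (1 − θ_M(a₀N²))` — at an (early) diffusive time the
finite chain retains at most `C'` times what the half-line proxy retains (continuum ratio `1 + ℓ√a₀/A`):
bounded response relative to the half-line retention, no rate claimed on either. -/
theorem stub_farBathCost :
    ∀ ω₂ lam β γ : ℝ, 0 < ω₂ → 0 < lam → 0 < β → 0 < γ → ∀ T : ℝ, 0 < T → (let P := Literature.MathematicalPhysics.KineticTheory.HeatConduction.pinnedChain ω₂ lam β γ; let K : ℕ → ℝ → ℝ := fun N u => if h : 0 < N then ∫ z, ((z.2 ⟨0, h⟩) ^ 2 - T) * (∫ y, ((y.2 ⟨0, h⟩) ^ 2 - T) ∂(P.transitionKernel N T T u.toNNReal z)) ∂(P.gibbsMeasure N T) else 0; let θ : ℕ → ℝ → ℝ := fun N t => γ / T ^ 2 * ∫ u in (0 : ℝ)..t, K N u; ∃ a₀ C' : ℝ, 0 < a₀ ∧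 ∀ᶠ N : ℕ in Filter.atTop, ∀ᶠ M : ℕ in Filter.atTop, 1 - θ N (a₀ * (N : ℝ) ^ 2) ≤ C' * (1 - θ M (a₀ * (N : ℝ) ^ 2))) := by
  sorry

/-! ## The composition (all sorry-free) -/

/-- **Abstract mesh of the line** (pure real analysis over an arbitrary deficit functional `E` and curve `θ`):
late saturation + no overshoot (one chain, two times) and the two far-bath comparisons (two chains, one
time) give the two-sided crossover bracket, with `c₂ = c·c'(a₁)` and `C₂ = C·C'` (`C ≥ 0`) or `C·c'(a₀)`
(`C ≤ 0`). -/
theorem crossover_of_saturation_of_comparison (E : ℕ → ℝ) (θ : ℕ → ℝ → ℝ)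
    (h1 : ∃ a₁ c : ℝ, 0 < a₁ ∧ 0 < c ∧
      ∀ᶠ N : ℕ in Filter.atTop, c * (1 - θ N (a₁ * (N : ℝ) ^ 2)) ≤ E N)
    (h2 : ∀ a : ℝ, 0 < a → ∃ C : ℝ,
      ∀ᶠ N : ℕ in Filter.atTop, E N ≤ C * (1 - θ N (a * (N : ℝ) ^ 2)))
    (h3 : ∀ a : ℝ, 0 < a → ∃ c' : ℝ, 0 < c' ∧
      ∀ᶠ N : ℕ in Filter.atTop, ∀ᶠ M : ℕ in Filter.atTop,
        c' * (1 - θ M (a * (N : ℝ) ^ 2)) ≤ 1 - θ N (a * (N : ℝ) ^ 2))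
    (h4 : ∃ a₀ C' : ℝ, 0 < a₀ ∧
      ∀ᶠ N : ℕ in Filter.atTop, ∀ᶠ M : ℕ in Filter.atTop,
        1 - θ N (a₀ * (N : ℝ) ^ 2) ≤ C' * (1 - θ M (a₀ * (N : ℝ) ^ 2))) :
    ∃ a₀ a₁ c₂ C₂ : ℝ, 0 < a₀ ∧ 0 < a₁ ∧ 0 < c₂ ∧
      ∀ᶠ N : ℕ in Filter.atTop, ∀ᶠ M : ℕ in Filter.atTop,
        c₂ * (1 - θ M (a₁ * (N : ℝ) ^ 2)) ≤ E N ∧ E N ≤ C₂ * (1 - θ M (a₀ * (N : ℝ) ^ 2)) := by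
  obtain ⟨a₁, c, ha₁, hc, hlow⟩ := h1
  obtain ⟨a₀, C', ha₀, hcost⟩ := h4
  obtain ⟨C, hup⟩ := h2 a₀ ha₀
  obtain ⟨c₁, hc₁, hsign₁⟩ := h3 a₁ ha₁
  obtain ⟨c₀, hc₀, hsign₀⟩ := h3 a₀ ha₀
  -- LOWER bound (late saturation ∘ far-bath sign at `a₁`), eventually in `N`, then in `M`.
  have hL : ∀ᶠ N : ℕ in Filter.atTop, ∀ᶠ M : ℕ in Filter.atTop,
      c * c₁ * (1 - θ M (a₁ * (N : ℝ) ^ 2)) ≤ E N := by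
    filter_upwards [hlow, hsign₁] with N hlo hsg
    filter_upwards [hsg] with M hsgM
    calc c * c₁ * (1 - θ M (a₁ * (N : ℝ) ^ 2))
        = c * (c₁ * (1 - θ M (a₁ * (N : ℝ) ^ 2))) := by ring
      _ ≤ c * (1 - θ N (a₁ * (N : ℝ) ^ 2)) := mul_le_mul_of_nonneg_left hsgM hc.le
      _ ≤ E N := hlo
  -- UPPER bound (no overshoot ∘ far-bath cost at `a₀`); the sign of `C` decides which comparison is used.
  rcases le_total 0 C with hC0 | hC0
  · refine ⟨a₀, a₁, c * c₁, C * C', ha₀, ha₁, mul_pos hc hc₁, ?_⟩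
    filter_upwards [hL, hup, hcost] with N hLN hupN hcoN
    filter_upwards [hLN, hcoN] with M hLM hcoM
    refine ⟨hLM, ?_⟩
    calc E N ≤ C * (1 - θ N (a₀ * (N : ℝ) ^ 2)) := hupN
      _ ≤ C * (C' * (1 - θ M (a₀ * (N : ℝ) ^ 2))) := mul_le_mul_of_nonneg_left hcoM hC0
      _ = C * C' * (1 - θ M (a₀ * (N : ℝ) ^ 2)) := by ring
  · refine ⟨a₀, a₁, c * c₁, C * c₀, ha₀, ha₁, mul_pos hc hc₁, ?_⟩
    filter_upwards [hL, hup, hsign₀] with N hLN hupN hsgN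
    filter_upwards [hLN, hsgN] with M hLM hsgM
    refine ⟨hLM, ?_⟩
    calc E N ≤ C * (1 - θ N (a₀ * (N : ℝ) ^ 2)) := hupN
      _ ≤ C * (c₀ * (1 - θ M (a₀ * (N : ℝ) ^ 2))) := mul_le_mul_of_nonpos_left hsgM hC0
      _ = C * c₀ * (1 - θ M (a₀ * (N : ℝ) ^ 2)) := by ring

/-- **The implication, sorry-free**: `stub_lateSaturation`-statement → `stub_noOvershoot`-statement →
`stub_farBathSign`-statement → `stub_farBathCost`-statement → the statement of
`BoundaryEscapeDeficit.DiffusiveCrossover` (conclusion = the crux's definiens VERBATIM, so that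
`DiffusiveCrossover_of` below is this term at the crux's name). The `let`-bound `K, θ, E` of the four
stubs and of the crux are introduced once and shared by definitional unfolding. -/
theorem diffusiveCrossover_of_stubs :
    (∀ ω₂ lam β γ : ℝ, 0 < ω₂ → 0 < lam → 0 < β → 0 < γ → ∀ T : ℝ, 0 < T → (let P := Literature.MathematicalPhysics.KineticTheory.HeatConduction.pinnedChain ω₂ lam β γ; let K : ℕ → ℝ → ℝ := fun N u => if h : 0 < N then ∫ z, ((z.2 ⟨0, h⟩) ^ 2 - T) * (∫ y, ((y.2 ⟨0, h⟩) ^ 2 - T) ∂(P.transitionKernel N T T u.toNNReal z)) ∂(P.gibbsMeasure N T) else 0; let θ : ℕ → ℝ → ℝ := fun N t => γ / T ^ 2 * ∫ u in (0 : ℝ)..t, K N u; let E : ℕ → ℝ := fun N => 1 - γ / T ^ 2 * ∫ u in Set.Ioi (0 : ℝ), K N u; ∃ a₁ c : ℝ, 0 < a₁ ∧ 0 < c ∧ ∀ᶠ N : ℕ in Filter.atTop, c * (1 - θ N (a₁ * (N : ℝ) ^ 2)) ≤ E N)) →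
    (∀ ω₂ lam β γ : ℝ, 0 < ω₂ → 0 < lam → 0 < β → 0 < γ → ∀ T : ℝ, 0 < T → (let P := Literature.MathematicalPhysics.KineticTheory.HeatConduction.pinnedChain ω₂ lam β γ; let K : ℕ → ℝ → ℝ := fun N u => if h : 0 < N then ∫ z, ((z.2 ⟨0, h⟩) ^ 2 - T) * (∫ y, ((y.2 ⟨0, h⟩) ^ 2 - T) ∂(P.transitionKernel N T T u.toNNReal z)) ∂(P.gibbsMeasure N T) else 0; let θ : ℕ → ℝ → ℝ := fun N t => γ / T ^ 2 * ∫ u in (0 : ℝ)..t, K N u; let E : ℕ → ℝ := fun N => 1 - γ / T ^ 2 * ∫ u in Set.Ioi (0 : ℝ), K N u; ∀ a : ℝ, 0 < a → ∃ C : ℝ, ∀ᶠ N : ℕ in Filter.atTop, E N ≤ C * (1 - θ N (a * (N : ℝ) ^ 2)))) →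
    (∀ ω₂ lam β γ : ℝ, 0 < ω₂ → 0 < lam → 0 < β → 0 < γ → ∀ T : ℝ, 0 < T → (let P := Literature.MathematicalPhysics.KineticTheory.HeatConduction.pinnedChain ω₂ lam β γ; let K : ℕ → ℝ → ℝ := fun N u => if h : 0 < N then ∫ z, ((z.2 ⟨0, h⟩) ^ 2 - T) * (∫ y, ((y.2 ⟨0, h⟩) ^ 2 - T) ∂(P.transitionKernel N T T u.toNNReal z)) ∂(P.gibbsMeasure N T) else 0; let θ : ℕ → ℝ → ℝ := fun N t => γ / T ^ 2 * ∫ u in (0 : ℝ)..t, K N u; ∀ a : ℝ, 0 < a → ∃ c' : ℝ, 0 < c' ∧ ∀ᶠ N : ℕ in Filter.atTop, ∀ᶠ M : ℕ in Filter.atTop, c' * (1 - θ M (a * (N : ℝ) ^ 2)) ≤ 1 - θ N (a * (N : ℝ) ^ 2))) →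
    (∀ ω₂ lam β γ : ℝ, 0 < ω₂ → 0 < lam → 0 < β → 0 < γ → ∀ T : ℝ, 0 < T → (let P := Literature.MathematicalPhysics.KineticTheory.HeatConduction.pinnedChain ω₂ lam β γ; let K : ℕ → ℝ → ℝ := fun N u => if h : 0 < N then ∫ z, ((z.2 ⟨0, h⟩) ^ 2 - T) * (∫ y, ((y.2 ⟨0, h⟩) ^ 2 - T) ∂(P.transitionKernel N T T u.toNNReal z)) ∂(P.gibbsMeasure N T) else 0; let θ : ℕ → ℝ → ℝ := fun N t => γ / T ^ 2 * ∫ u in (0 : ℝ)..t, K N u; ∃ a₀ C' : ℝ, 0 < a₀ ∧ ∀ᶠ N : ℕ in Filter.atTop, ∀ᶠ M : ℕ in Filter.atTop, 1 - θ N (a₀ * (N : ℝ) ^ 2) ≤ C' * (1 - θ M (a₀ * (N : ℝ) ^ 2)))) →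
    (∀ ω₂ lam β γ : ℝ, 0 < ω₂ → 0 < lam → 0 < β → 0 < γ → ∀ T : ℝ, 0 < T → (let P := Literature.MathematicalPhysics.KineticTheory.HeatConduction.pinnedChain ω₂ lam β γ; let K : ℕ → ℝ → ℝ := fun N u => if h : 0 < N then ∫ z, ((z.2 ⟨0, h⟩) ^ 2 - T) * (∫ y, ((y.2 ⟨0, h⟩) ^ 2 - T) ∂(P.transitionKernel N T T u.toNNReal z)) ∂(P.gibbsMeasure N T) else 0; let θ : ℕ → ℝ → ℝ := fun N t => γ / T ^ 2 * ∫ u in (0 : ℝ)..t, K N u; let E : ℕ → ℝ := fun N => 1 - γ / T ^ 2 * ∫ u in Set.Ioi (0 : ℝ), K N u; ∃ a₀ a₁ c₂ C₂ : ℝ, 0 < a₀ ∧ 0 < a₁ ∧ 0 < c₂ ∧ ∀ᶠ N : ℕ in Filter.atTop, ∀ᶠ M : ℕ in Filter.atTop, c₂ * (1 - θ M (a₁ * (N : ℝ) ^ 2)) ≤ E N ∧ E N ≤ C₂ * (1 - θ M (a₀ * (N : ℝ) ^ 2)))) := by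
  intro hS1 hS2 hS3 hS4 ω₂ lam β γ hω hl hβ hγ T hT P K θ E
  exact crossover_of_saturation_of_comparison E θ
    (hS1 ω₂ lam β γ hω hl hβ hγ T hT) (hS2 ω₂ lam β γ hω hl hβ hγ T hT)
    (hS3 ω₂ lam β γ hω hl hβ hγ T hT) (hS4 ω₂ lam β γ hω hl hβ hγ T hT)

/-- **Skeleton theorem — the crux `BoundaryEscapeDeficit.DiffusiveCrossover` BY NAME from the four registered
stubs** (the only theorem of this file concluding the crux; its `sorry`s are exactly those of
`stub_lateSaturation`, `stub_noOvershoot`, `stub_farBathSign`, `stub_farBathCost`; the seam is the sorry-free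
`diffusiveCrossover_of_stubs` / `crossover_of_saturation_of_comparison`). -/
theorem DiffusiveCrossover_of :
    _root_.Summit.AtomisticToContinuum.FouriersLaw.Theses.BoundaryEscapeDeficit.DiffusiveCrossover :=
  diffusiveCrossover_of_stubs stub_lateSaturation stub_noOvershoot stub_farBathSign stub_farBathCost

end Birth

end Summit.AtomisticToContinuum.FouriersLaw.Cruxes.DiffusiveCrossover

end
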